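import Summits.BirchSwinnertonDyer.BirchSwinnertonDyer.Theorems.PrintCf2RubinValueTwoFrameSeedAvatars
import Summits.BirchSwinnertonDyer.BirchSwinnertonDyer.Theorems.PrintCf2RubinValueTwoFrameSeedLocalMatching
import Summits.BirchSwinnertonDyer.BirchSwinnertonDyer.Theorems.PrintCf2SplitBadTwoFrameFieldPinning
import Literature.NumberTheory.EllipticCurves.RohrlichAnticyclotomicTwistsCMForms
import HarnessLib

/-!
# B18s — THE SEED SUPPLY ON AN S2′ FRAME: for every quadratic `θK` there is a seed `η` through the
# `ℤ₂²`-tower with `θK⁻¹η` unramified at the split dyadic place `v`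
# (crux `stmt-BirchSwinnertonDyer-23721` `PrintCf2RubinValueTwo.RubinValueFormulaAtTwo`, line
# `value-transport`, stub B18s `stub_frameSeed_two` — file 5, the assembly)

Cell `bsd-print-cf2`, seat `cruxlead-23721` g3.  Theses-free; `--supports` the crux; no definitions.
**`frameSeed_two`** has EXACTLY the registered signature `FrameSeedAtTwo` of the line `value-transport`
(`Cruxes/RubinValueFormulaAtTwo/Lines/value_transport.lean`): on every S2′ frame (member of the cm7 twist
class, `K ≅ ℚ(√−7)` pinned by `L(ψ, s) = L(W, s)`, `2 = v v̄`, `ι` pinned to `v`, a generator pair of the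
`ℤ₂²`-tower, `θK` quadratic and unramified off `Sθ ∪ {v, v̄}`) there are a Hecke character `η`, a `2`-adic
avatar `e` of `η` THROUGH THE PAIR, and `b ≤ a` with `η` unramified away from `2`, `θK⁻¹η` of type
`(−a, b)` and unramified at every `w ∉ Sθ ∪ {v̄}` — so that B18 (two-variable Katz frame uniqueness at
`p = 2`, -w5 g4 p680279) applies to `λ' = θK⁻¹η` and B18t (p683009) transports uniqueness back to `θK⁻¹`:
U_S2′ (`RubinValueFormulaKernel.frameUnique_two_of_seed`, p683956) becomes unconditional.

The seed: `θK|𝒪_vˣ` is one of the four characters of `(ℤ/8)ˣ`, read on `⟨−1⟩_v, ⟨5⟩_v` (file 4); the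
matching seed is `ω_A⁻²`, `ω_A⁻¹`, `ω_B⁻¹` or `ω_A⁻¹ω_B⁻¹` for the Größencharaktere `ω_A, ω_B` of
`χ₄ = χ₈χ₈'` and `χ₈'` modulo `𝔭_v³` (file 2), whose inverse avatars factor through every generator pair
(file 3); `η` is unramified off `v`, of type `(−a, 0)`, `a ∈ {1, 2}`.  NO parity bookkeeping at `v` is
needed: the density argument absorbs it.

* `core` — the seed for (`K` imaginary quadratic ∋ `√−7`, `ord_v 2 = 1`, `ι` pinned to `v`, `θK² = 1`).
* `frameSeed_two : <FrameSeedAtTwo verbatim>` — the frame's `√−7 ∈ K` and `ord_v 2 = 1` come from the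
  pinning theorems `FramePinning.exists_sq_eq_neg_seven_of_frame`, `FirstLayer.intValuation_two_of_frame`.

HONEST FRAMING: closes the registered stub B18s of the (now aside) v10 item 23721 — infrastructure for
Katz-measure uniqueness on real S2′ frames at `p = 2`; it does NOT touch the research stub R, and the
v11 crux 24034 does not need it.  beyond-print theorem: no.  BSD is not proved by any of this.

References: [deShalit1987] II.4.17 (52)–(54); [SerreAbelianLadic1968] Ch. II §2.7; [IrelandRosen1982]
Ch. 18 §7; [Omeara1963] §63A.
-/

-- the summit namespace `Summit.BirchSwinnertonDyer.BirchSwinnertonDyer` repeats the problem name by design (D-0017)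
set_option linter.dupNamespace false
set_option autoImplicit false

noncomputable section

open scoped Classical

open NumberField IsDedekindDomain Field WeierstrassCurve Literature.NumberTheory.GaloisRepresentations
  Literature.NumberTheory.EllipticCurves Literature.NumberTheory.EllipticCurves.Rank1Residual

namespace Summit.BirchSwinnertonDyer.BirchSwinnertonDyer.Theorems.PrintCf2.FrameSeed

variable {K : Type} [Field K] [NumberField K]

/-! ## §1 Small algebra -/

/-- `χ₈, χ₈'` at `±1, ±5 ∈ ℤ/8`. [folklore] -/
private theorem chi_table :
    ZMod.χ₈ (1 : ZMod (2 ^ 3)) = 1 ∧ ZMod.χ₈ (-1 : ZMod (2 ^ 3)) = 1 ∧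
    ZMod.χ₈ (5 : ZMod (2 ^ 3)) = -1 ∧ ZMod.χ₈ (-5 : ZMod (2 ^ 3)) = -1 ∧
    ZMod.χ₈' (1 : ZMod (2 ^ 3)) = 1 ∧ ZMod.χ₈' (-1 : ZMod (2 ^ 3)) = -1 ∧
    ZMod.χ₈' (5 : ZMod (2 ^ 3)) = -1 ∧ ZMod.χ₈' (-5 : ZMod (2 ^ 3)) = 1 := by
  decide

/-- The odd characters `χ₄ = χ₈χ₈'` and `χ₈'` of `(ℤ/8)ˣ` take the value `−1` at `−1`. [folklore] -/
private theorem chi_odd : (ZMod.χ₈ * ZMod.χ₈') (-1 : ZMod 8) = -1 ∧ ZMod.χ₈' (-1 : ZMod 8) = -1 := by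
  decide

/-- `(χ₈χ₈')(x) = χ₈(x)χ₈'(x)`. [folklore] -/
private theorem chi4_apply (x : ZMod 8) : (ZMod.χ₈ * ZMod.χ₈') x = ZMod.χ₈ x * ZMod.χ₈' x := rfl

/-- A quadratic Hecke character is its own inverse. [folklore] -/
theorem inv_eq_self_of_mul_self {θK : HeckeCharacter K} (hθ : θK * θK = 1) : θK⁻¹ = θK :=
  inv_eq_of_mul_eq_one_right hθ

/-- A quadratic Hecke character has infinity type `(0, 0)`. [cite: NeukirchANT1999, Ch. VII (6.9)] -/
theorem hasInfinityType_zero_of_mul_self {θK : HeckeCharacter K} (hθ : θK * θK = 1) :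
    θK.HasInfinityType (fun _ ↦ 0) (fun _ ↦ 0) :=
  hasInfinityType_zero_of_isFiniteOrder (isOfFinOrder_iff_pow_eq_one.mpr ⟨2, two_pos, by rw [pow_two, hθ]⟩)

/-- Values of a quadratic Hecke character are `±1`. [folklore] -/
theorem coe_apply_eq_one_or_of_mul_self {θK : HeckeCharacter K} (hθ : θK * θK = 1) (x : ideleGroup K) :
    ((θK x : ℂˣ) : ℂ) = 1 ∨ ((θK x : ℂˣ) : ℂ) = -1 := by
  have h := congrArg (fun χ : HeckeCharacter K ↦ ((χ x : ℂˣ) : ℂ)) hθ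
  simp only [HeckeCharacter.mul_apply, HeckeCharacter.one_apply, Units.val_mul, Units.val_one] at h
  exact mul_self_eq_one_iff.mp h

/-! ## §2 The matching at `v` from the two signs `θK(⟨−1⟩_v), θK(⟨5⟩_v)` -/

section Signs

variable {v : HeightOneSpectrum (𝓞 K)} {φ₀ : 𝓞 K →+* ℤ_[2]}
  (hv : ∀ k : 𝓞 K, k ∈ v.asIdeal ↔ (2 : ℤ_[2]) ∣ φ₀ k)
  (h2v : v.intValuation (2 : 𝓞 K) = WithZero.exp (-1 : ℤ))
include hv h2v

/-- **Matching from signs.**  In the situation of `isUnramifiedAt_inv_mul_of_reps`, the four representative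
conditions reduce to `c(1) = 1`, `c(−1) = θK(⟨−1⟩_v)`, `c(5) = θK(⟨5⟩_v)`, `c(−5) = θK(⟨−1⟩_v)θK(⟨5⟩_v)`.
[cite: Omeara1963, §63A Cor. 63:1b] [cite: deShalit1987, II.4.17 (54)] -/
theorem isUnramifiedAt_inv_mul_of_signs {θK η : HeckeCharacter K} (hθ : θK * θK = 1)
    (c : ZMod (2 ^ 3) → ℂ)
    (hηcong : ∀ q : (v.adicCompletion K)ˣ,
      Valued.v ((q : v.adicCompletion K) - 1) ≤ WithZero.exp (-(3 : ℤ)) → η (localUnits v q) = 1)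
    (hηval : ∀ a : 𝓞 K, a ∉ v.asIdeal → ∀ ha : algebraMap K (v.adicCompletion K) (a : K) ≠ 0,
      ((η (localUnits v (Units.mk0 _ ha)) : ℂˣ) : ℂ) = c (PadicInt.toZModPow 3 (φ₀ a)))
    {s₁ s₅ : ℂ}
    (hs₁ : ∀ ha : algebraMap K (v.adicCompletion K) ((-1 : 𝓞 K) : K) ≠ 0,
      ((θK (localUnits v (Units.mk0 _ ha)) : ℂˣ) : ℂ) = s₁)
    (hs₅ : ∀ ha : algebraMap K (v.adicCompletion K) ((5 : 𝓞 K) : K) ≠ 0,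
      ((θK (localUnits v (Units.mk0 _ ha)) : ℂˣ) : ℂ) = s₅)
    (hc1 : c 1 = 1) (hcn1 : c (-1) = s₁) (hc5 : c 5 = s₅) (hcn5 : c (-5) = s₁ * s₅) :
    (θK⁻¹ * η).IsUnramifiedAt v := by
  refine isUnramifiedAt_inv_mul_of_reps hv h2v hθ c hηcong hηval fun a₀ ha₀ ha ↦ ?_
  have hne : ∀ b : 𝓞 K, b ∉ v.asIdeal → algebraMap K (v.adicCompletion K) (b : K) ≠ 0 := fun b hb h0 ↦ by
    have h1 : Valued.v (algebraMap K (v.adicCompletion K) (b : K)) = 1 := by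
      rw [Literature.NumberTheory.GaloisRepresentations.valued_algebraMap_adicCompletion,
        RingOfIntegers.coe_eq_algebraMap, HeightOneSpectrum.valuation_of_algebraMap,
        HeightOneSpectrum.intValuation_eq_one_iff.mpr hb]
    rw [h0, map_zero] at h1; exact zero_ne_one h1
  have hn1 : (-1 : 𝓞 K) ∉ v.asIdeal := rep_not_mem h2v (Or.inr (Or.inl rfl))
  have h5 : (5 : 𝓞 K) ∉ v.asIdeal := rep_not_mem h2v (Or.inr (Or.inr (Or.inl rfl)))
  rcases ha₀ with rfl | rfl | rfl | rfl
  · -- `a₀ = 1`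
    have hu : Units.mk0 (algebraMap K (v.adicCompletion K) ((1 : 𝓞 K) : K)) ha = 1 :=
      Units.ext (by rw [Units.val_mk0, Units.val_one, RingOfIntegers.coe_eq_algebraMap, map_one, map_one])
    rw [hu, map_one, map_one, Units.val_one, map_one, map_one, hc1]
  · -- `a₀ = -1`
    rw [hs₁ ha, map_neg, map_one, map_neg, map_one, hcn1]
  · -- `a₀ = 5`
    rw [hs₅ ha, map_ofNat, map_ofNat, hc5]
  · -- `a₀ = -5`
    have hK5 : ((-5 : 𝓞 K) : K) = ((-1 : 𝓞 K) : K) * ((5 : 𝓞 K) : K) := by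
      simp only [map_neg, map_one, map_ofNat]; norm_num
    have hu : Units.mk0 (algebraMap K (v.adicCompletion K) ((-5 : 𝓞 K) : K)) ha =
        Units.mk0 _ (hne _ hn1) * Units.mk0 _ (hne _ h5) :=
      Units.ext (by rw [Units.val_mul, Units.val_mk0, Units.val_mk0, Units.val_mk0, ← map_mul, hK5])
    rw [hu, map_mul, map_mul, Units.val_mul, hs₁, hs₅, map_neg, map_ofNat, map_neg, map_ofNat, hcn5]

end Signs

/-! ## §3 The generic finish: from a matched seed to the conclusion of B18s -/

section Finish

variable {v vbar : HeightOneSpectrum (𝓞 K)} (hv2 : ((2 : ℕ) : 𝓞 K) ∈ v.asIdeal)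
  {ι : PadicAlgCl 2 ≃+* ℂ} {κ₁ κ₂ : ZpExtension K 2} {θK : HeckeCharacter K} (hθ : θK * θK = 1)
  {Sθ : Finset (HeightOneSpectrum (𝓞 K))}
  (hSunr : ∀ w : HeightOneSpectrum (𝓞 K), w ∉ Sθ → w ≠ v → w ≠ vbar → θK.IsUnramifiedAt w)
include hv2 hθ hSunr

/-- **From a matched seed to B18s' conclusion**: a Hecke character `η` of type `(−a, 0)`, unramified off `v`,
with a `2`-adic avatar through the pair and `θK⁻¹η` unramified at `v`, is a seed.
[cite: deShalit1987, II.4.17 (54)] -/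
theorem seed_of_matched {η : HeckeCharacter K} {e : FramedGaloisRep K (PadicAlgCl 2) 1} {a : ℕ}
    (he : IsPAdicAvatarOf ι η e) (hfe : FactorsThroughPair κ₁ κ₂ e)
    (hηu : ∀ w : HeightOneSpectrum (𝓞 K), w ≠ v → η.IsUnramifiedAt w)
    (hηt : η.HasInfinityType (fun _ ↦ -(a : ℤ)) (fun _ ↦ 0))
    (hmatch : (θK⁻¹ * η).IsUnramifiedAt v) :
    ∃ (η : HeckeCharacter K) (e : FramedGaloisRep K (PadicAlgCl 2) 1) (a b : ℕ),
      IsPAdicAvatarOf ι η e ∧ FactorsThroughPair κ₁ κ₂ e ∧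
      (∀ w : HeightOneSpectrum (𝓞 K), ((2 : ℕ) : 𝓞 K) ∉ w.asIdeal → η.IsUnramifiedAt w) ∧
      b ≤ a ∧ (θK⁻¹ * η).HasInfinityType (fun _ ↦ -(a : ℤ)) (fun _ ↦ (b : ℤ)) ∧
      ∀ w : HeightOneSpectrum (𝓞 K), w ∉ Sθ → w ≠ vbar → (θK⁻¹ * η).IsUnramifiedAt w := by
  refine ⟨η, e, a, 0, he, hfe, fun w hw ↦ hηu w (by rintro rfl; exact hw hv2), Nat.zero_le a, ?_, ?_⟩
  · have hθt : θK⁻¹.HasInfinityType (fun _ ↦ 0) (fun _ ↦ 0) := by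
      rw [inv_eq_self_of_mul_self hθ]; exact hasInfinityType_zero_of_mul_self hθ
    have h := hθt.mul' hηt
    have e1 : ((fun _ ↦ 0) + (fun _ ↦ -(a : ℤ)) : InfinitePlace K → ℤ) = fun _ ↦ -(a : ℤ) := by
      funext w; simp
    have e2 : ((fun _ ↦ 0) + (fun _ ↦ 0) : InfinitePlace K → ℤ) = fun _ ↦ ((0 : ℕ) : ℤ) := by
      funext w; simp
    rw [e1, e2] at h
    exact h
  · intro w hwS hwvbar
    by_cases hwv : w = v
    · subst hwv; exact hmatch
    · exact (hSunr w hwS hwv hwvbar).inv'.mul' (hηu w hwv)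

end Finish

/-! ## §4 The core: the seed for a quadratic `θK` -/

section Core

/-- **THE SEED SUPPLY (core form).**  `K` imaginary quadratic with `√−7 ∈ K`; `v` a place with
`2 ∈ 𝔭_v`, `ord_v 2 = 1`; `ι : ℚ̄₂ ≃+* ℂ` pinned to `v`; `(κ₁, κ₂; γ₁, γ₂)` a generator pair of the
`ℤ₂²`-tower; `θK` a Hecke character with `θK² = 1`, unramified off `Sθ ∪ {v, v̄}`.  Then there are `η`, a
`2`-adic avatar `e` of `η` through the pair, and `b ≤ a` with `η` unramified away from `2`, `θK⁻¹η` of type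
`(−a, b)` and unramified at every `w ∉ Sθ ∪ {v̄}`. [cite: deShalit1987, II.4.17 (52)–(54)]
[cite: SerreAbelianLadic1968, Ch. II §2.7] [cite: IrelandRosen1982, Ch. 18 §7] -/
theorem exists_seed_core (hK : IsImaginaryQuadratic K) {θ : K} (hθ7 : θ ^ 2 = -7)
    {v vbar : HeightOneSpectrum (𝓞 K)} (hv2 : ((2 : ℕ) : 𝓞 K) ∈ v.asIdeal)
    (h2v : v.intValuation (2 : 𝓞 K) = WithZero.exp (-1 : ℤ))
    (ι : PadicAlgCl 2 ≃+* ℂ)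
    (hι : ∀ (w : InfinitePlace K) (k : 𝓞 K), k ∈ v.asIdeal ↔ ‖ι.symm (w.embedding (k : K))‖ < 1)
    {κ₁ κ₂ : ZpExtension K 2} {γ₁ γ₂ : absoluteGaloisGroup K} (hpair : ZpExtension.IsTopGeneratorPair κ₁ κ₂ γ₁ γ₂)
    {θK : HeckeCharacter K} (hθ : θK * θK = 1) {Sθ : Finset (HeightOneSpectrum (𝓞 K))}
    (hSunr : ∀ w : HeightOneSpectrum (𝓞 K), w ∉ Sθ → w ≠ v → w ≠ vbar → θK.IsUnramifiedAt w) :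
    ∃ (η : HeckeCharacter K) (e : FramedGaloisRep K (PadicAlgCl 2) 1) (a b : ℕ),
      IsPAdicAvatarOf ι η e ∧ FactorsThroughPair κ₁ κ₂ e ∧
      (∀ w : HeightOneSpectrum (𝓞 K), ((2 : ℕ) : 𝓞 K) ∉ w.asIdeal → η.IsUnramifiedAt w) ∧
      b ≤ a ∧ (θK⁻¹ * η).HasInfinityType (fun _ ↦ -(a : ℤ)) (fun _ ↦ (b : ℤ)) ∧
      ∀ w : HeightOneSpectrum (𝓞 K), w ∉ Sθ → w ≠ vbar → (θK⁻¹ * η).IsUnramifiedAt w := by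
  -- the infinite place and the embedding `𝓞 K → ℤ₂`
  obtain ⟨w₀⟩ : Nonempty (InfinitePlace K) := inferInstance
  haveI : Subsingleton (InfinitePlace K) :=
    Fintype.card_le_one_iff_subsingleton.mp hK.card_infinitePlace_eq_one.le
  have he : ∀ w : InfinitePlace K, w.embedding = w₀.embedding := fun w ↦ by rw [Subsingleton.elim w w₀]
  set φK : K →+* PadicAlgCl 2 := (ι.symm : ℂ ≃+* PadicAlgCl 2).toRingHom.comp w₀.embedding with hφK
  have hφKv : ∀ k : 𝓞 K, k ∈ v.asIdeal ↔ ‖φK (k : K)‖ < 1 := fun k ↦ hι w₀ k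
  obtain ⟨φ₀, hφ₀⟩ := exists_intEmb hK.1 hθ7 φK
  have hφe : ∀ k : 𝓞 K, algebraMap ℚ_[2] (PadicAlgCl 2) ((φ₀ k : ℤ_[2]) : ℚ_[2]) = ι.symm (w₀.embedding (k : K)) :=
    hφ₀
  have hvd : ∀ k : 𝓞 K, k ∈ v.asIdeal ↔ (2 : ℤ_[2]) ∣ φ₀ k := mem_iff_two_dvd_of_norm hφ₀ hφKv
  -- the two seed Größencharaktere and their inverse avatars
  obtain ⟨ωA, ωB, ⟨hAi, hBi⟩, hU, hF, hL, hC⟩ :=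
    exists_seedChar_pair hK hθ7 he hvd (ZMod.χ₈ * ZMod.χ₈') ZMod.χ₈' chi_odd.1 chi_odd.2
  have hF' : ∀ w : HeightOneSpectrum (𝓞 K), ∃ g : 𝓞 K, w ≠ v → (g ∉ v.asIdeal ∧
      ωA.valueAtUniformizer w =
        w₀.embedding (g : K) * (((ZMod.χ₈ * ZMod.χ₈') (PadicInt.toZModPow 3 (φ₀ g)) : ℤ) : ℂ)⁻¹ ∧
      ωB.valueAtUniformizer w =
        w₀.embedding (g : K) * ((ZMod.χ₈' (PadicInt.toZModPow 3 (φ₀ g)) : ℤ) : ℂ)⁻¹) := by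
    intro w
    by_cases h : w ≠ v
    · obtain ⟨g, hg⟩ := hF w h
      exact ⟨g, fun _ ↦ hg⟩
    · exact ⟨0, fun h' ↦ absurd h' h⟩
  choose g hgall using hF'
  have hg : ∀ w : HeightOneSpectrum (𝓞 K), w ≠ v → g w ∉ v.asIdeal := fun w h ↦ (hgall w h).1
  have hgA : ∀ w : HeightOneSpectrum (𝓞 K), w ≠ v → ωA.valueAtUniformizer w =
      w₀.embedding (g w : K) * (((ZMod.χ₈ * ZMod.χ₈') (PadicInt.toZModPow 3 (φ₀ (g w))) : ℤ) : ℂ)⁻¹ :=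
    fun w h ↦ (hgall w h).2.1
  have hgB : ∀ w : HeightOneSpectrum (𝓞 K), w ≠ v → ωB.valueAtUniformizer w =
      w₀.embedding (g w : K) * ((ZMod.χ₈' (PadicInt.toZModPow 3 (φ₀ (g w))) : ℤ) : ℂ)⁻¹ :=
    fun w h ↦ (hgall w h).2.2
  obtain ⟨rA, χzA, hrA, heA, hfrA⟩ :=
    exists_unitsChar_avatar_inv ι hφe hvd ⟨_, _, hAi⟩ (fun w h ↦ (hU w h).1) hg hgA
  obtain ⟨rB, χzB, hrB, heB, hfrB⟩ :=
    exists_unitsChar_avatar_inv ι hφe hvd ⟨_, _, hBi⟩ (fun w h ↦ (hU w h).2) hg hgB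
  have hfrA' : ∀ w : HeightOneSpectrum (𝓞 K), w ≠ v → ((2 : ℕ) : 𝓞 K) ∉ w.asIdeal →
      ∀ 𝔓 ∈ w.primesAbove, ∀ Φ : absoluteGaloisGroup K, IsArithFrobAt (𝓞 K) Φ 𝔓 →
        ((χzA Φ : ℤ_[2]ˣ) : ℤ_[2]) = φ₀ (g w) *
          ((ZMod.χ₈ (PadicInt.toZModPow 3 (φ₀ (g w))) * ZMod.χ₈' (PadicInt.toZModPow 3 (φ₀ (g w))) : ℤ) : ℤ_[2]) :=
    fun w h h2 𝔓 h𝔓 Φ hΦ ↦ by rw [hfrA w h h2 𝔓 h𝔓 Φ hΦ, chi4_apply]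
  have hfA : FactorsThroughPair κ₁ κ₂ rA := factorsThroughPair_of_principal hvd hK hpair heA hg hfrA'
  have hfB : FactorsThroughPair κ₁ κ₂ rB := factorsThroughPair_of_rel hvd heA heB hg hfrA' hfrB hfA
  -- inverse seeds: unramified off `v`, type `(-1, 0)`
  have hAu : ∀ w : HeightOneSpectrum (𝓞 K), w ≠ v → ωA⁻¹.IsUnramifiedAt w := fun w h ↦ (hU w h).1.inv'
  have hBu : ∀ w : HeightOneSpectrum (𝓞 K), w ≠ v → ωB⁻¹.IsUnramifiedAt w := fun w h ↦ (hU w h).2.inv'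
  have hAu2 : ∀ w : HeightOneSpectrum (𝓞 K), ((2 : ℕ) : 𝓞 K) ∉ w.asIdeal → ωA⁻¹.IsUnramifiedAt w :=
    fun w hw ↦ hAu w (by rintro rfl; exact hw hv2)
  have hAt : ωA⁻¹.HasInfinityType (fun _ ↦ -((1 : ℕ) : ℤ)) (fun _ ↦ 0) := by
    have h := hAi.inv
    have e1 : (-(fun _ ↦ 1 : InfinitePlace K → ℤ)) = fun _ ↦ -((1 : ℕ) : ℤ) := by funext w; simp
    have e2 : (-(fun _ ↦ 0 : InfinitePlace K → ℤ)) = fun _ ↦ 0 := by funext w; simp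
    rw [e1, e2] at h; exact h
  have hBt : ωB⁻¹.HasInfinityType (fun _ ↦ -((1 : ℕ) : ℤ)) (fun _ ↦ 0) := by
    have h := hBi.inv
    have e1 : (-(fun _ ↦ 1 : InfinitePlace K → ℤ)) = fun _ ↦ -((1 : ℕ) : ℤ) := by funext w; simp
    have e2 : (-(fun _ ↦ 0 : InfinitePlace K → ℤ)) = fun _ ↦ 0 := by funext w; simp
    rw [e1, e2] at h; exact h
  have htwo : ∀ {η₁ η₂ : HeckeCharacter K}, η₁.HasInfinityType (fun _ ↦ -((1 : ℕ) : ℤ)) (fun _ ↦ 0) →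
      η₂.HasInfinityType (fun _ ↦ -((1 : ℕ) : ℤ)) (fun _ ↦ 0) →
      (η₁ * η₂).HasInfinityType (fun _ ↦ -((2 : ℕ) : ℤ)) (fun _ ↦ 0) := by
    intro η₁ η₂ h₁ h₂
    have h := h₁.mul' h₂
    have e1 : ((fun _ ↦ -((1 : ℕ) : ℤ)) + (fun _ ↦ -((1 : ℕ) : ℤ)) : InfinitePlace K → ℤ) =
        fun _ ↦ -((2 : ℕ) : ℤ) := by funext w; norm_num
    have e2 : ((fun _ ↦ 0) + (fun _ ↦ 0) : InfinitePlace K → ℤ) = fun _ ↦ 0 := by funext w; simp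
    rw [e1, e2] at h; exact h
  -- congruence subgroup and local values of the inverse seeds
  have hAc : ∀ q : (v.adicCompletion K)ˣ, Valued.v ((q : v.adicCompletion K) - 1) ≤ WithZero.exp (-(3 : ℤ)) →
      ωA⁻¹ (localUnits v q) = 1 := fun q hq ↦ by rw [HeckeCharacter.inv_apply, (hC q hq).1, inv_one]
  have hBc : ∀ q : (v.adicCompletion K)ˣ, Valued.v ((q : v.adicCompletion K) - 1) ≤ WithZero.exp (-(3 : ℤ)) →
      ωB⁻¹ (localUnits v q) = 1 := fun q hq ↦ by rw [HeckeCharacter.inv_apply, (hC q hq).2, inv_one]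
  have hAl : ∀ a : 𝓞 K, a ∉ v.asIdeal → ∀ ha : algebraMap K (v.adicCompletion K) (a : K) ≠ 0,
      ((ωA⁻¹ (localUnits v (Units.mk0 _ ha)) : ℂˣ) : ℂ) =
        ((((ZMod.χ₈ * ZMod.χ₈') (PadicInt.toZModPow 3 (φ₀ a))) : ℤ) : ℂ)⁻¹ := fun a ha haK ↦ by
    rw [HeckeCharacter.inv_apply, Units.val_inv_eq_inv_val, (hL a ha haK).1]
  have hBl : ∀ a : 𝓞 K, a ∉ v.asIdeal → ∀ ha : algebraMap K (v.adicCompletion K) (a : K) ≠ 0,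
      ((ωB⁻¹ (localUnits v (Units.mk0 _ ha)) : ℂˣ) : ℂ) =
        (((ZMod.χ₈' (PadicInt.toZModPow 3 (φ₀ a))) : ℤ) : ℂ)⁻¹ := fun a ha haK ↦ by
    rw [HeckeCharacter.inv_apply, Units.val_inv_eq_inv_val, (hL a ha haK).2]
  -- the two signs of `θK` at `v`
  have hne : ∀ b : 𝓞 K, b ∉ v.asIdeal → algebraMap K (v.adicCompletion K) (b : K) ≠ 0 := fun b hb h0 ↦ by
    have h1 : Valued.v (algebraMap K (v.adicCompletion K) (b : K)) = 1 := by
      rw [Literature.NumberTheory.GaloisRepresentations.valued_algebraMap_adicCompletion,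
        RingOfIntegers.coe_eq_algebraMap, HeightOneSpectrum.valuation_of_algebraMap,
        HeightOneSpectrum.intValuation_eq_one_iff.mpr hb]
    rw [h0, map_zero] at h1; exact zero_ne_one h1
  have hn1 : (-1 : 𝓞 K) ∉ v.asIdeal := rep_not_mem h2v (Or.inr (Or.inl rfl))
  have h5 : (5 : 𝓞 K) ∉ v.asIdeal := rep_not_mem h2v (Or.inr (Or.inr (Or.inl rfl)))
  set s₁ : ℂ := ((θK (localUnits v (Units.mk0 _ (hne _ hn1))) : ℂˣ) : ℂ) with hs₁def
  set s₅ : ℂ := ((θK (localUnits v (Units.mk0 _ (hne _ h5))) : ℂˣ) : ℂ) with hs₅def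
  have hs₁ : ∀ ha : algebraMap K (v.adicCompletion K) ((-1 : 𝓞 K) : K) ≠ 0,
      ((θK (localUnits v (Units.mk0 _ ha)) : ℂˣ) : ℂ) = s₁ := fun _ ↦ rfl
  have hs₅ : ∀ ha : algebraMap K (v.adicCompletion K) ((5 : 𝓞 K) : K) ≠ 0,
      ((θK (localUnits v (Units.mk0 _ ha)) : ℂˣ) : ℂ) = s₅ := fun _ ↦ rfl
  obtain ⟨t1, tn1, t5, tn5, t1', tn1', t5', tn5'⟩ := chi_table
  -- four cases
  rcases coe_apply_eq_one_or_of_mul_self hθ (localUnits v (Units.mk0 _ (hne _ hn1))) with e₁ | e₁ <;>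
    rcases coe_apply_eq_one_or_of_mul_self hθ (localUnits v (Units.mk0 _ (hne _ h5))) with e₅ | e₅ <;>
    rw [← hs₁def] at e₁ <;> rw [← hs₅def] at e₅
  · -- `θK|𝒪_vˣ = 1`: seed `ω_A⁻²`
    refine seed_of_matched hv2 hθ hSunr (hrA.mul_twist hrA hAu2) (factorsThroughPair_twist_detChar hfA hfA)
      (fun w h ↦ (hAu w h).mul' (hAu w h)) (htwo hAt hAt) ?_
    refine isUnramifiedAt_inv_mul_of_signs hvd h2v hθ
      (fun t ↦ ((((ZMod.χ₈ * ZMod.χ₈') t) : ℤ) : ℂ)⁻¹ * ((((ZMod.χ₈ * ZMod.χ₈') t) : ℤ) : ℂ)⁻¹)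
      (fun q hq ↦ by rw [HeckeCharacter.mul_apply, hAc q hq, one_mul])
      (fun a ha haK ↦ by rw [HeckeCharacter.mul_apply, Units.val_mul, hAl a ha haK]) hs₁ hs₅ ?_ ?_ ?_ ?_
    all_goals simp only [chi4_apply, t1, tn1, t5, tn5, t1', tn1', t5', tn5', e₁, e₅]; norm_num
  · -- `θK(⟨−1⟩) = 1, θK(⟨5⟩) = −1` (`χ₈`): seed `ω_A⁻¹ω_B⁻¹`
    refine seed_of_matched hv2 hθ hSunr (hrB.mul_twist hrA hAu2) (factorsThroughPair_twist_detChar hfB hfA)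
      (fun w h ↦ (hAu w h).mul' (hBu w h)) (htwo hAt hBt) ?_
    refine isUnramifiedAt_inv_mul_of_signs hvd h2v hθ
      (fun t ↦ ((((ZMod.χ₈ * ZMod.χ₈') t) : ℤ) : ℂ)⁻¹ * (((ZMod.χ₈' t) : ℤ) : ℂ)⁻¹)
      (fun q hq ↦ by rw [HeckeCharacter.mul_apply, hAc q hq, hBc q hq, one_mul])
      (fun a ha haK ↦ by rw [HeckeCharacter.mul_apply, Units.val_mul, hAl a ha haK, hBl a ha haK]) hs₁ hs₅ ?_ ?_ ?_ ?_
    all_goals simp only [chi4_apply, t1, tn1, t5, tn5, t1', tn1', t5', tn5', e₁, e₅]; norm_num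
  · -- `θK(⟨−1⟩) = −1, θK(⟨5⟩) = 1` (`χ₄`): seed `ω_A⁻¹`
    refine seed_of_matched hv2 hθ hSunr hrA hfA hAu hAt ?_
    refine isUnramifiedAt_inv_mul_of_signs hvd h2v hθ
      (fun t ↦ ((((ZMod.χ₈ * ZMod.χ₈') t) : ℤ) : ℂ)⁻¹) hAc hAl hs₁ hs₅ ?_ ?_ ?_ ?_
    all_goals simp only [chi4_apply, t1, tn1, t5, tn5, t1', tn1', t5', tn5', e₁, e₅]; norm_num
  · -- `θK(⟨−1⟩) = −1, θK(⟨5⟩) = −1` (`χ₈'`): seed `ω_B⁻¹`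
    refine seed_of_matched hv2 hθ hSunr hrB hfB hBu hBt ?_
    refine isUnramifiedAt_inv_mul_of_signs hvd h2v hθ
      (fun t ↦ (((ZMod.χ₈' t) : ℤ) : ℂ)⁻¹) hBc hBl hs₁ hs₅ ?_ ?_ ?_ ?_
    all_goals simp only [t1', tn1', t5', tn5', e₁, e₅]; norm_num

end Core

/-! ## §5 B18s on the S2′ frame (the registered signature `FrameSeedAtTwo`, verbatim) -/

/-- **B18s — THE SEED SUPPLY ON EVERY S2′ FRAME** (statement = `FrameSeedAtTwo` of the line
`value-transport`, VERBATIM): for every member and every v10 frame of crux 23721 there are a Hecke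
character `η`, a `2`-adic avatar `e` of `η` through the pair `(κ₁, κ₂)`, and `b ≤ a`, such that `η` is
unramified away from `2`, `θK⁻¹η` has infinity type `(−a, b)` and is unramified at every `w ∉ Sθ ∪ {v̄}`.
[cite: deShalit1987, II.4.17 (52)–(54)] [cite: SerreAbelianLadic1968, Ch. II §2.7]
[cite: IrelandRosen1982, Ch. 18 §7] -/
theorem frameSeed_two :
    ∀ (d : ℤ), d ≠ 0 → Squarefree d → d % 4 ≠ 1 →
    ∀ (W : WeierstrassCurve ℚ) [W.IsElliptic] [W.IsGloballyMinimal] (C : VariableChange ℚ),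
      C • W = cm7.quadraticTwist (d : ℚ) → W.analyticRank = 1 →
    ∀ (K : Type) [Field K] [NumberField K], IsImaginaryQuadratic K →
    ∀ (v vbar : HeightOneSpectrum (𝓞 K)),
      ((2 : ℕ) : 𝓞 K) ∈ v.asIdeal → ((2 : ℕ) : 𝓞 K) ∈ vbar.asIdeal → vbar ≠ v →
    ∀ (ι : PadicAlgCl 2 ≃+* ℂ),
      (∀ (w : InfinitePlace K) (k : 𝓞 K), k ∈ v.asIdeal ↔ ‖ι.symm (w.embedding (k : K))‖ < 1) →
    ∀ (c : K ≃ₐ[ℚ] K), c ≠ 1 →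
    ∀ (ψ : HeckeCharacter K), ψ.HasInfinityType (fun _ ↦ 1) (fun _ ↦ 0) →
      (∀ s : ℂ, 3 / 2 < s.re → heckeLFunction ψ s = W.LSeries s) →
    ∀ (κ₁ κ₂ : ZpExtension K 2) (γ₁ γ₂ : absoluteGaloisGroup K), ZpExtension.IsTopGeneratorPair κ₁ κ₂ γ₁ γ₂ →
    ∀ (θK ρ : HeckeCharacter K) (r : FramedGaloisRep K (PadicAlgCl 2) 1),
      θK * θK = 1 → IsPAdicAvatarOf ι ρ r → FactorsThroughPair κ₁ κ₂ r →
      θK⁻¹ * ρ = (HeckeCharacter.galConj c ψ)⁻¹ →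
    ∀ (Sθ : Finset (HeightOneSpectrum (𝓞 K))), v ∉ Sθ → vbar ∉ Sθ →
      (∀ w ∈ Sθ, ¬ θK.IsUnramifiedAt w) →
      (∀ w : HeightOneSpectrum (𝓞 K), w ∉ Sθ → w ≠ v → w ≠ vbar → θK.IsUnramifiedAt w) →
    ∃ (η : HeckeCharacter K) (e : FramedGaloisRep K (PadicAlgCl 2) 1) (a b : ℕ),
      IsPAdicAvatarOf ι η e ∧ FactorsThroughPair κ₁ κ₂ e ∧
      (∀ w : HeightOneSpectrum (𝓞 K), ((2 : ℕ) : 𝓞 K) ∉ w.asIdeal → η.IsUnramifiedAt w) ∧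
      b ≤ a ∧ (θK⁻¹ * η).HasInfinityType (fun _ ↦ -(a : ℤ)) (fun _ ↦ (b : ℤ)) ∧
      ∀ w : HeightOneSpectrum (𝓞 K), w ∉ Sθ → w ≠ vbar → (θK⁻¹ * η).IsUnramifiedAt w := by
  intro d hd0 _ _ W _ _ C hC _ K _ _ hK v vbar hv hvbar hne ι hι _ _ ψ _ hL κ₁ κ₂ γ₁ γ₂ hpair
    θK _ _ hθ _ _ _ Sθ _ _ _ hSunr
  obtain ⟨⟨θ, hθ7⟩, -⟩ := FramePinning.exists_sq_eq_neg_seven_of_frame hd0 W hC hK hv hvbar hne hL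
  have h2v : v.intValuation (2 : 𝓞 K) = WithZero.exp (-1 : ℤ) := by
    have h := FirstLayer.intValuation_two_of_frame hK hθ7 hd0 W hC hv
    simpa using h
  exact exists_seed_core hK hθ7 hv h2v ι hι hpair hθ hSunr

end Summit.BirchSwinnertonDyer.BirchSwinnertonDyer.Theorems.PrintCf2.FrameSeed

end
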